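import Summits.AtomisticToContinuum.BoseEinsteinCondensation.Theses.BECModePrice
import Summits.AtomisticToContinuum.BoseEinsteinCondensation.Theorems.BECConjugateDominationHardCoreExtensionNearMinTowerNecessityCore
import Summits.AtomisticToContinuum.BoseEinsteinCondensation.Theorems.BECConjugateDominationHardCoreExtensionMaxFormApproximationFiniteRange
import Literature.MathematicalPhysics.QuantumManyBody.PeriodicBoseGasFracEnergy
import Literature.MathematicalPhysics.QuantumManyBody.BoseGasDirichletWall
import Literature.Barriers.AtomisticToContinuum.KineticGapLengthScalesThermodynamicWindow
import HarnessLib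

/-!
# Necessity of the tower shadow: SMS for `v` forces height-uniform SMS along `min(v,n)`
# (crux `BECModePrice.ModePriceHardCore`, stmt-AtomisticToContinuum-18513 — line `IdeatorSketchK1` / tower-shadow,
# stub `stub_uniformTower_of_modePrice`)

The single-mode-softening inequality SMS(w, C) at an instance `(N, L = L_N(ρ), p)` says: for every periodic
`C¹` trial state `Ψ`, `E₀^per(w; N, L) + X_p(Ψ) ≤ E_w(Ψ) + Cρ` with `X_p(Ψ) = ½|2πp/L|² n_p(Ψ)`,
`n_p(Ψ) = cellOccupation N L (planeWaveMode L p) Ψ` the occupation of the plane wave `p`.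

* `abs_toReal_cellOccupation_planeWaveMode_sub_le` — the plane-wave occupation is `2N`-Lipschitz on the unit
  ball of `L²(Λ^N)`: `|n_p(Φ) - n_p(Ψ)| ≤ 2N ‖Φ - Ψ‖₂` (`√n_p = ‖a_p ·‖` is a seminorm bounded by `√N‖·‖₂`,
  the `p`-analogue of `abs_toReal_condensateOccupation_sub_le`);
* `towerModePrice_fixedVolume` — at fixed `(N, L, p)` with `E₀(v) < ⊤`: SMS(v) with bonus `B` implies, for
  every `ε > 0`, SMS(min(v,n)) with bonus `B + ε` for all levels `n ≥ n₀`. A violating sequence `Ψ_j` at levels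
  `n_j → ∞` has `E_{min(v,n_j)}(Ψ_j) < E₀(v) + X_p(Ψ_j) - B - ε`; along a subsequence `X_p(Ψ_j) → x`
  (Bolzano–Weierstrass, `X_p ≤ ½|k|²N`), Rellich + Fatou up the tower (`exists_limitProfile_of_energy_le`) give
  an `L²`-limit `η` of maximal `v`-form energy `≤ E₀(v) + x + ε/4 - B - ε`, the hard-core max-form `C¹`
  approximation (`stub_maxFormApproximationFiniteRange`) a `C¹` state `Φ` near `η` in energy and in `L²`,
  and SMS(v) at `Φ` plus the Lipschitz bound contradict the violation;
* `stub_uniformTower_of_modePrice` — the registered stub: thermodynamic assembly with constant `2C`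
  (`ε = Cρ`), `E₀(v; N, L_N) < ⊤` eventually by Ruelle finiteness
  (`exists_eventually_periodicGroundStateEnergy_lt_top`).

References: E. H. Lieb, R. Seiringer, J. P. Solovej, J. Yngvason, *The Mathematics of the Bose Gas and its
Condensation* (2005), §1.2 (1.17)–(1.18), App. A (A.11)–(A.13); M. Reed, B. Simon, *Methods of Modern
Mathematical Physics IV* (1978), Thm XIII.64; B. Simon, J. Operator Theory 1 (1979) 37–47, Thm 2.1.
-/

noncomputable section

namespace Summit.AtomisticToContinuum.BoseEinsteinCondensation.Cruxes.ModePriceHardCore.TowerShadow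

open MeasureTheory Filter
open scoped ENNReal NNReal Topology
open Literature.MathematicalPhysics.QuantumManyBody.BoseGas
open UnitAddTorus
open Summit.AtomisticToContinuum.BoseEinsteinCondensation.Cruxes.StaticResponseBound.UvThomsonForceWave
  (measurable_zeroProfile lintegral_periodicInteraction_zero_ne_top)
open Summit.AtomisticToContinuum.BoseEinsteinCondensation.Cruxes.HardCoreExtension.NearMinTower

/-! ## `L²`-Lipschitz continuity of the plane-wave occupations on the unit ball -/

/-- **`a_p` is bounded by `√N`**: `n_p(Ψ) ≤ N ∫_{Λ^N} |Ψ|²` for every continuous `N`-body function (the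
`p`-th term of Parseval `Σ_q n_q(Ψ) = N‖Ψ‖²`). [cite: LSSY2005, §1.2 (1.18) and App. A (A.11)] -/
theorem cellOccupation_planeWaveMode_le_card_mul_lintegral {N : ℕ} {L : ℝ} (hL : 0 < L) (p : Fin 3 → ℤ)
    {Ψ : Config N → ℂ} (hΨ : Continuous Ψ) :
    cellOccupation N L (planeWaveMode L p) Ψ ≤ (N : ℝ≥0∞) * ∫⁻ X in cellN N L, (‖Ψ X‖₊ : ℝ≥0∞) ^ 2 := by
  rw [← tsum_cellOccupation_planeWaveMode_eq hL hΨ]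
  exact ENNReal.le_tsum p

/-- `n_p` of a continuous function in the unit ball of `L²(Λ^N)` is finite (`≤ N`).
[cite: LSSY2005, §1.2 (1.18)] -/
theorem cellOccupation_planeWaveMode_ne_top_of_lintegral_le_one {N : ℕ} {L : ℝ} (hL : 0 < L)
    (p : Fin 3 → ℤ) {Ψ : Config N → ℂ} (hΨ : Continuous Ψ)
    (hΨ1 : ∫⁻ X in cellN N L, (‖Ψ X‖₊ : ℝ≥0∞) ^ 2 ≤ 1) :
    cellOccupation N L (planeWaveMode L p) Ψ ≠ ⊤ := by
  refine ne_top_of_le_ne_top (ENNReal.natCast_ne_top N) ?_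
  calc cellOccupation N L (planeWaveMode L p) Ψ ≤ (N : ℝ≥0∞) * ∫⁻ X in cellN N L, (‖Ψ X‖₊ : ℝ≥0∞) ^ 2 :=
        cellOccupation_planeWaveMode_le_card_mul_lintegral hL p hΨ
    _ ≤ (N : ℝ≥0∞) * 1 := by gcongr
    _ = N := mul_one _

/-- **`√n_p` is a seminorm** on continuous `N`-body functions: `√n_p(Φ) ≤ √n_p(Ψ) + √n_p(Φ - Ψ)`
(`√n_p = ‖a_p ·‖_{L²(Λ^{N-1})}`, linearity of `a_p = a(φ_p)` and Minkowski). [cite: LSSY2005, App. A (A.13)] -/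
theorem cellOccupation_planeWaveMode_rpow_half_le_add {N : ℕ} (L : ℝ) (p : Fin 3 → ℤ)
    {Φ Ψ : Config N → ℂ} (hΦ : Continuous Φ) (hΨ : Continuous Ψ) :
    cellOccupation N L (planeWaveMode L p) Φ ^ (1 / 2 : ℝ) ≤
      cellOccupation N L (planeWaveMode L p) Ψ ^ (1 / 2 : ℝ) +
        cellOccupation N L (planeWaveMode L p) (fun X => Φ X - Ψ X) ^ (1 / 2 : ℝ) := by
  cases N with
  | zero => simp [cellOccupation, occupation]
  | succ n =>
    simp only [cellOccupation_eq_lintegral_modeAn]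
    have hφm : Measurable (planeWaveMode L p) := (continuous_planeWaveMode L p).measurable
    have hφb : ∀ x, ‖planeWaveMode L p x‖ ≤ (Real.sqrt (L ^ 3))⁻¹ := fun x => (norm_planeWaveMode L p x).le
    -- linearity of `a_p`
    have hlin : modeAn L (planeWaveMode L p) Φ =
        modeAn L (planeWaveMode L p) Ψ + modeAn L (planeWaveMode L p) (fun X => Φ X - Ψ X) := by
      rw [← modeAn_add L (planeWaveMode L p) Ψ (fun X => Φ X - Ψ X)
        (fun Y => integrableOn_cell_conj_mul hφm hφb (continuous_vecCons_slice hΨ Y))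
        (fun Y => integrableOn_cell_conj_mul hφm hφb (continuous_vecCons_slice (hΦ.sub hΨ) Y))]
      congr 1
      funext X
      simp
    -- pointwise triangle inequality
    have hpt : ∀ Y, (‖modeAn L (planeWaveMode L p) Φ Y‖₊ : ℝ≥0∞) ≤
        (‖modeAn L (planeWaveMode L p) Ψ Y‖₊ : ℝ≥0∞) +
          (‖modeAn L (planeWaveMode L p) (fun X => Φ X - Ψ X) Y‖₊ : ℝ≥0∞) := by
      intro Y
      rw [hlin, Pi.add_apply]
      exact_mod_cast nnnorm_add_le _ _
    -- Minkowski in `L²(Λⁿ)`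
    have hmΨ : AEMeasurable (fun Y => (‖modeAn L (planeWaveMode L p) Ψ Y‖₊ : ℝ≥0∞))
        (volume.restrict (cellN n L)) :=
      (measurable_modeAn L hφm hΨ.measurable).nnnorm.coe_nnreal_ennreal.aemeasurable
    have hmD : AEMeasurable (fun Y => (‖modeAn L (planeWaveMode L p) (fun X => Φ X - Ψ X) Y‖₊ : ℝ≥0∞))
        (volume.restrict (cellN n L)) :=
      (measurable_modeAn L hφm (hΦ.sub hΨ).measurable).nnnorm.coe_nnreal_ennreal.aemeasurable
    have hmink := ENNReal.lintegral_Lp_add_le (μ := volume.restrict (cellN n L)) hmΨ hmD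
      (by norm_num : (1 : ℝ) ≤ 2)
    simp only [Pi.add_apply, ENNReal.rpow_two] at hmink
    refine le_trans ?_ hmink
    gcongr with Y
    exact hpt Y

/-- **`L²`-Lipschitz continuity of the plane-wave occupation on the unit ball** (`ℝ≥0∞` form): for continuous
`Φ, Ψ` with `∫_{Λ^N}|Φ|² ≤ 1`, `∫_{Λ^N}|Ψ|² ≤ 1`, `n_p(Φ) ≤ n_p(Ψ) + 2N (∫_{Λ^N} |Φ - Ψ|²)^{1/2}`
(`√n_p` is a seminorm bounded by `√N ‖·‖₂`, and `a² - b² = (a - b)(a + b)`). [cite: LSSY2005, App. A (A.11), (A.13)] -/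
theorem cellOccupation_planeWaveMode_le_add_lintegral_rpow {N : ℕ} {L : ℝ} (hL : 0 < L) (p : Fin 3 → ℤ)
    {Φ Ψ : Config N → ℂ} (hΦ : Continuous Φ) (hΨ : Continuous Ψ)
    (hΦ1 : ∫⁻ X in cellN N L, (‖Φ X‖₊ : ℝ≥0∞) ^ 2 ≤ 1)
    (hΨ1 : ∫⁻ X in cellN N L, (‖Ψ X‖₊ : ℝ≥0∞) ^ 2 ≤ 1) :
    cellOccupation N L (planeWaveMode L p) Φ ≤ cellOccupation N L (planeWaveMode L p) Ψ +
      2 * N * (∫⁻ X in cellN N L, (‖Φ X - Ψ X‖₊ : ℝ≥0∞) ^ 2) ^ (1 / 2 : ℝ) := by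
  have hsq : ∀ x : ℝ≥0∞, (x ^ (1 / 2 : ℝ)) ^ 2 = x := fun x => by
    rw [← ENNReal.rpow_two, ← ENNReal.rpow_mul]
    norm_num
  have habd := cellOccupation_planeWaveMode_rpow_half_le_add L p hΦ hΨ
  have hdle : cellOccupation N L (planeWaveMode L p) (fun X => Φ X - Ψ X) ^ (1 / 2 : ℝ) ≤
      (N : ℝ≥0∞) ^ (1 / 2 : ℝ) * (∫⁻ X in cellN N L, (‖Φ X - Ψ X‖₊ : ℝ≥0∞) ^ 2) ^ (1 / 2 : ℝ) := by
    rw [← ENNReal.mul_rpow_of_nonneg _ _ (by norm_num)]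
    exact ENNReal.rpow_le_rpow (cellOccupation_planeWaveMode_le_card_mul_lintegral hL p (hΦ.sub hΨ))
      (by norm_num)
  have hbound : ∀ {F : Config N → ℂ}, Continuous F →
      (∫⁻ X in cellN N L, (‖F X‖₊ : ℝ≥0∞) ^ 2 ≤ 1) →
      cellOccupation N L (planeWaveMode L p) F ^ (1 / 2 : ℝ) ≤ (N : ℝ≥0∞) ^ (1 / 2 : ℝ) := by
    intro F hF hF1
    refine ENNReal.rpow_le_rpow ?_ (by norm_num)
    calc cellOccupation N L (planeWaveMode L p) F ≤ (N : ℝ≥0∞) * ∫⁻ X in cellN N L, (‖F X‖₊ : ℝ≥0∞) ^ 2 :=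
          cellOccupation_planeWaveMode_le_card_mul_lintegral hL p hF
      _ ≤ (N : ℝ≥0∞) * 1 := by gcongr
      _ = N := mul_one _
  calc cellOccupation N L (planeWaveMode L p) Φ = (cellOccupation N L (planeWaveMode L p) Φ ^ (1 / 2 : ℝ)) ^ 2 :=
        (hsq _).symm
    _ ≤ (cellOccupation N L (planeWaveMode L p) Ψ ^ (1 / 2 : ℝ)) ^ 2 +
          2 * ((N : ℝ≥0∞) ^ (1 / 2 : ℝ) * (N : ℝ≥0∞) ^ (1 / 2 : ℝ)) *
            (∫⁻ X in cellN N L, (‖Φ X - Ψ X‖₊ : ℝ≥0∞) ^ 2) ^ (1 / 2 : ℝ) :=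
        sq_le_sq_add_of_le_add habd (hbound hΦ hΦ1) (hbound hΨ hΨ1) hdle
    _ = cellOccupation N L (planeWaveMode L p) Ψ +
          2 * N * (∫⁻ X in cellN N L, (‖Φ X - Ψ X‖₊ : ℝ≥0∞) ^ 2) ^ (1 / 2 : ℝ) := by
        rw [hsq, ← sq, hsq]

/-- **`L²`-Lipschitz continuity of the plane-wave occupation, real Bochner form**: for continuous `Φ, Ψ` in the
unit ball of `L²(Λ^N)` and `∫_{Λ^N}‖Φ - Ψ‖² ≤ η`, `n_p(Φ) ≤ n_p(Ψ) + 2N√η`. [cite: LSSY2005, App. A (A.11), (A.13)] -/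
theorem cellOccupation_planeWaveMode_le_add_of_sq_dist_le {N : ℕ} {L : ℝ} (hL : 0 < L) (p : Fin 3 → ℤ)
    {Φ Ψ : Config N → ℂ} (hΦ : Continuous Φ) (hΨ : Continuous Ψ)
    (hΦ1 : ∫⁻ X in cellN N L, (‖Φ X‖₊ : ℝ≥0∞) ^ 2 ≤ 1)
    (hΨ1 : ∫⁻ X in cellN N L, (‖Ψ X‖₊ : ℝ≥0∞) ^ 2 ≤ 1) {η : ℝ}
    (hη : ∫ X in cellN N L, ‖Φ X - Ψ X‖ ^ 2 ≤ η) :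
    cellOccupation N L (planeWaveMode L p) Φ ≤
      cellOccupation N L (planeWaveMode L p) Ψ + ENNReal.ofReal (2 * N * Real.sqrt η) := by
  have hη0 : 0 ≤ η := le_trans (integral_nonneg fun X => by positivity) hη
  calc cellOccupation N L (planeWaveMode L p) Φ ≤ cellOccupation N L (planeWaveMode L p) Ψ +
        2 * N * (∫⁻ X in cellN N L, (‖Φ X - Ψ X‖₊ : ℝ≥0∞) ^ 2) ^ (1 / 2 : ℝ) :=
        cellOccupation_planeWaveMode_le_add_lintegral_rpow hL p hΦ hΨ hΦ1 hΨ1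
    _ ≤ cellOccupation N L (planeWaveMode L p) Ψ + 2 * N * (ENNReal.ofReal η) ^ (1 / 2 : ℝ) := by
        rw [lintegral_cellN_nnnorm_sq_eq_ofReal L (F := fun X => Φ X - Ψ X) (hΦ.sub hΨ)]
        gcongr
    _ = cellOccupation N L (planeWaveMode L p) Ψ + ENNReal.ofReal (2 * N * Real.sqrt η) := by
        rw [ofReal_rpow_half_eq_sqrt hη0, two_mul_natCast_mul_ofReal N (Real.sqrt η)]

/-- **`L²`-Lipschitz continuity of the plane-wave occupation**: `|n_p(Φ) - n_p(Ψ)| ≤ 2N ‖Φ - Ψ‖_{L²(Λ^N)}` for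
continuous `Φ, Ψ` in the unit ball of `L²(Λ^N)` (`n_p = N‖P_pΨ‖²` with `P_p` the one-particle projection onto the
plane wave `p`, a contraction). [cite: LSSY2005, App. A (A.11), (A.13)] -/
theorem abs_toReal_cellOccupation_planeWaveMode_sub_le {N : ℕ} {L : ℝ} (hL : 0 < L) (p : Fin 3 → ℤ)
    {Φ Ψ : Config N → ℂ} (hΦ : Continuous Φ) (hΨ : Continuous Ψ)
    (hΦ1 : ∫⁻ X in cellN N L, (‖Φ X‖₊ : ℝ≥0∞) ^ 2 ≤ 1)
    (hΨ1 : ∫⁻ X in cellN N L, (‖Ψ X‖₊ : ℝ≥0∞) ^ 2 ≤ 1) :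
    |(cellOccupation N L (planeWaveMode L p) Φ).toReal - (cellOccupation N L (planeWaveMode L p) Ψ).toReal| ≤
      2 * N * Real.sqrt (∫ X in cellN N L, ‖Φ X - Ψ X‖ ^ 2) := by
  set η : ℝ := ∫ X in cellN N L, ‖Φ X - Ψ X‖ ^ 2 with hηdef
  have hR : 0 ≤ 2 * N * Real.sqrt η := by positivity
  have hΦfin := cellOccupation_planeWaveMode_ne_top_of_lintegral_le_one hL p hΦ hΦ1
  have hΨfin := cellOccupation_planeWaveMode_ne_top_of_lintegral_le_one hL p hΨ hΨ1
  have h1 := cellOccupation_planeWaveMode_le_add_of_sq_dist_le hL p hΦ hΨ hΦ1 hΨ1 (le_refl η)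
  have hη' : ∫ X in cellN N L, ‖Ψ X - Φ X‖ ^ 2 ≤ η := by
    refine le_of_eq (hηdef ▸ integral_congr_ae (ae_of_all _ fun X => ?_))
    simp only [norm_sub_rev]
  have h2 := cellOccupation_planeWaveMode_le_add_of_sq_dist_le hL p hΨ hΦ hΨ1 hΦ1 hη'
  rw [abs_sub_le_iff]
  constructor
  · have := ENNReal.toReal_mono (ENNReal.add_ne_top.2 ⟨hΨfin, ENNReal.ofReal_ne_top⟩) h1
    rw [ENNReal.toReal_add hΨfin ENNReal.ofReal_ne_top, ENNReal.toReal_ofReal hR] at this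
    linarith
  · have := ENNReal.toReal_mono (ENNReal.add_ne_top.2 ⟨hΦfin, ENNReal.ofReal_ne_top⟩) h2
    rw [ENNReal.toReal_add hΦfin ENNReal.ofReal_ne_top, ENNReal.toReal_ofReal hR] at this
    linarith

/-! ## Necessity at fixed volume -/

/-- **Tower SMS from SMS at fixed volume.** At fixed `(N, L, p)` with `0 < L` and `E₀^per(v; N, L) < ⊤`: if
`E₀(v) + ½|k_p|² n_p(Ψ) ≤ E_v(Ψ) + B` for every periodic trial state (`B < ⊤`), then for every `ε > 0` there is
a level `n₀` beyond which `E₀(min(v,n)) + ½|k_p|² n_p(Ψ) ≤ E_{min(v,n)}(Ψ) + B + ε` for every periodic trial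
state (Bolzano–Weierstrass on `X_p(Ψ_j)`, Rellich + Fatou up the tower `exists_limitProfile_of_energy_le`,
the hard-core max-form approximation `stub_maxFormApproximationFiniteRange`, and the `2N`-Lipschitz bound
`abs_toReal_cellOccupation_planeWaveMode_sub_le`). [cite: ReedSimonIV1978, Thm XIII.64] -/
theorem towerModePrice_fixedVolume (v : ℝ → ℝ≥0∞) (hv : IsRepulsiveFiniteRange v) {N : ℕ} {L : ℝ}
    (hL : 0 < L) (hE : periodicGroundStateEnergy v N L ≠ ⊤) (p : Fin 3 → ℤ) {B : ℝ≥0∞} (hB : B ≠ ⊤)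
    (hSMS : ∀ Ψ : PeriodicTrialState N L,
      periodicGroundStateEnergy v N L + 2⁻¹ * fracDispersion 2 L p * cellOccupation N L (planeWaveMode L p) Ψ.ψ ≤
        periodicEnergy v Ψ + B)
    {ε : ℝ} (hε : 0 < ε) :
    ∃ n₀ : ℕ, ∀ n : ℕ, n₀ ≤ n → ∀ Ψ : PeriodicTrialState N L,
      periodicGroundStateEnergy (fun r => min (v r) (n : ℝ≥0∞)) N L +
          2⁻¹ * fracDispersion 2 L p * cellOccupation N L (planeWaveMode L p) Ψ.ψ ≤
        periodicEnergy (fun r => min (v r) (n : ℝ≥0∞)) Ψ + B + ENNReal.ofReal ε := by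
  -- the half dispersion `s = ½|k_p|²` and the bound `X_p(Ψ) = s n_p(Ψ) ≤ s N < ⊤`
  set s : ℝ≥0∞ := 2⁻¹ * fracDispersion 2 L p with hsdef
  have hstop : s ≠ ⊤ := ENNReal.mul_ne_top (ENNReal.inv_ne_top.2 two_ne_zero) (fracDispersion_ne_top 2 L p)
  have hsNtop : s * (N : ℝ≥0∞) ≠ ⊤ := ENNReal.mul_ne_top hstop (ENNReal.natCast_ne_top N)
  have hXle : ∀ Ψ : PeriodicTrialState N L, s * cellOccupation N L (planeWaveMode L p) Ψ.ψ ≤ s * N :=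
    fun Ψ => mul_le_mul_right (Ψ.cellOccupation_planeWaveMode_le hL p) s
  have hXtop : ∀ Ψ : PeriodicTrialState N L, s * cellOccupation N L (planeWaveMode L p) Ψ.ψ ≠ ⊤ :=
    fun Ψ => ne_top_of_le_ne_top hsNtop (hXle Ψ)
  by_contra hcon
  push Not at hcon
  -- a sequence of levels `k j ≥ j` and violating states `Ψ j`
  choose k hk Ψ hΨ using hcon
  have hE0le : ∀ j, periodicGroundStateEnergy (fun r => min (v r) ((k j : ℕ) : ℝ≥0∞)) N L ≤
      periodicGroundStateEnergy v N L :=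
    fun j => periodicGroundStateEnergy_mono_of_le fun r => min_le_left _ _
  -- Bolzano–Weierstrass for the bounded reals `x j = X_p(Ψ j)`
  obtain ⟨x, hx⟩ : ∃ x : ℕ → ℝ, ∀ j, x j = (s * cellOccupation N L (planeWaveMode L p) (Ψ j).ψ).toReal :=
    ⟨_, fun j => rfl⟩
  have hxmem : ∀ j, x j ∈ Set.Icc (0 : ℝ) ((s * N).toReal) := fun j =>
    ⟨(hx j).symm ▸ ENNReal.toReal_nonneg, (hx j).symm ▸ ENNReal.toReal_mono hsNtop (hXle (Ψ j))⟩
  obtain ⟨a, ha, φ, hφ, hlim⟩ := tendsto_subseq_of_bounded (Metric.isBounded_Icc (0 : ℝ) ((s * N).toReal)) hxmem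
  have ha0 : 0 ≤ a := by
    rw [closure_Icc] at ha
    exact ha.1
  have hθ : 0 < ε / 4 := by positivity
  obtain ⟨J, hJ⟩ := Metric.tendsto_atTop.1 hlim (ε / 4) hθ
  -- drop the first `J` terms: `|x (ψ₁ j) - a| < ε/4` for ALL `j`
  obtain ⟨ψ₁, hψ₁def⟩ : ∃ ψ₁ : ℕ → ℕ, ∀ j, ψ₁ j = φ (j + J) := ⟨_, fun j => rfl⟩
  have hψ₁ : StrictMono ψ₁ := fun i j hij => by
    rw [hψ₁def, hψ₁def]
    exact hφ (Nat.add_lt_add_right hij J)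
  have hclose : ∀ j, |x (ψ₁ j) - a| < ε / 4 := fun j => by
    have h := hJ (j + J) (Nat.le_add_left J j)
    rwa [Function.comp_apply, Real.dist_eq, ← hψ₁def] at h
  have hktend : Tendsto (fun j => k (ψ₁ j)) atTop atTop :=
    (tendsto_atTop_mono hk tendsto_id).comp hψ₁.tendsto_atTop
  -- the uniform energy bound along the shifted subsequence
  have hlt : ∀ j, periodicEnergy (fun r => min (v r) ((k (ψ₁ j) : ℕ) : ℝ≥0∞)) (Ψ (ψ₁ j)) + (B + ENNReal.ofReal ε) <
      periodicGroundStateEnergy v N L + ENNReal.ofReal (a + ε / 4) := fun j => by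
    have h2 : s * cellOccupation N L (planeWaveMode L p) (Ψ (ψ₁ j)).ψ ≤ ENNReal.ofReal (a + ε / 4) := by
      rw [← ENNReal.ofReal_toReal (hXtop (Ψ (ψ₁ j))), ← hx]
      refine ENNReal.ofReal_le_ofReal ?_
      have := (abs_lt.1 (hclose j)).2
      linarith
    calc periodicEnergy (fun r => min (v r) ((k (ψ₁ j) : ℕ) : ℝ≥0∞)) (Ψ (ψ₁ j)) + (B + ENNReal.ofReal ε)
        = periodicEnergy (fun r => min (v r) ((k (ψ₁ j) : ℕ) : ℝ≥0∞)) (Ψ (ψ₁ j)) + B + ENNReal.ofReal ε :=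
          (add_assoc _ _ _).symm
      _ < _ := hΨ (ψ₁ j)
      _ ≤ _ := add_le_add (hE0le _) h2
  have hSle : B + ENNReal.ofReal ε ≤ periodicGroundStateEnergy v N L + ENNReal.ofReal (a + ε / 4) :=
    le_add_self.trans (hlt 0).le
  have hStop : B + ENNReal.ofReal ε ≠ ⊤ := ENNReal.add_ne_top.2 ⟨hB, ENNReal.ofReal_ne_top⟩
  set Ebd : ℝ≥0∞ := periodicGroundStateEnergy v N L + ENNReal.ofReal (a + ε / 4) - (B + ENNReal.ofReal ε)
    with hEbd
  have hEbdtop : Ebd ≠ ⊤ :=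
    ne_top_of_le_ne_top (ENNReal.add_ne_top.2 ⟨hE, ENNReal.ofReal_ne_top⟩) tsub_le_self
  have hEbdS : Ebd + (B + ENNReal.ofReal ε) = periodicGroundStateEnergy v N L + ENNReal.ofReal (a + ε / 4) :=
    tsub_add_cancel_of_le hSle
  have hbound : ∀ j, periodicEnergy (fun r => min (v r) ((k (ψ₁ j) : ℕ) : ℝ≥0∞)) (Ψ (ψ₁ j)) ≤ Ebd :=
    fun j => ENNReal.le_sub_of_add_le_right hStop (hlt j).le
  -- Rellich + Fatou up the tower: the `L²`-limit `η`
  obtain ⟨η, hη1, hηsymm, hηE, φ₂, hφ₂, hconv⟩ :=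
    exists_limitProfile_of_energy_le (v := v) (w := fun n r => min (v r) (n : ℝ≥0∞))
      (fun n => hv.1.min measurable_const) (fun r i j hij => min_le_min le_rfl (by exact_mod_cast hij))
      (iSup_truncPotential v) hL hEbdtop hktend (fun j => Ψ (ψ₁ j)) hbound
  have hηEtop := ne_top_of_le_ne_top hEbdtop hηE
  -- the accuracy `ε' = ε / (2 + 8 s N)`
  set sr : ℝ := s.toReal with hsr
  have hsr0 : 0 ≤ sr := ENNReal.toReal_nonneg
  have hK0 : 0 < 2 + 8 * sr * N := by positivity
  obtain ⟨ε', hε'def⟩ : ∃ ε' : ℝ, ε' = ε / (2 + 8 * sr * N) := ⟨_, rfl⟩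
  have hε'0 : 0 < ε' := hε'def ▸ div_pos hε hK0
  have hε'K : ε' * (2 + 8 * sr * N) = ε := hε'def ▸ div_mul_cancel₀ ε hK0.ne'
  -- the hard-core max-form `C¹` approximation of `η`
  obtain ⟨Φ, hΦE, hΦdist⟩ := stub_maxFormApproximationFiniteRange v hv N L hL η hη1 hηsymm hηEtop ε' hε'0
  -- SMS(v) at `Φ`, `E₀(v)` cancelled, in real form
  have h7 : periodicGroundStateEnergy v N L + (s * cellOccupation N L (planeWaveMode L p) Φ.ψ + ENNReal.ofReal ε) ≤
      periodicGroundStateEnergy v N L + (ENNReal.ofReal (a + ε / 4) + ENNReal.ofReal ε') :=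
    calc periodicGroundStateEnergy v N L + (s * cellOccupation N L (planeWaveMode L p) Φ.ψ + ENNReal.ofReal ε)
        = periodicGroundStateEnergy v N L + s * cellOccupation N L (planeWaveMode L p) Φ.ψ + ENNReal.ofReal ε :=
          (add_assoc _ _ _).symm
      _ ≤ periodicEnergy v Φ + B + ENNReal.ofReal ε := add_le_add (hSMS Φ) le_rfl
      _ ≤ Ebd + ENNReal.ofReal ε' + B + ENNReal.ofReal ε := by
          gcongr
          exact hΦE.trans (add_le_add hηE le_rfl)
      _ = Ebd + (B + ENNReal.ofReal ε) + ENNReal.ofReal ε' := by ring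
      _ = _ := by rw [hEbdS, add_assoc]
  have h7r := ENNReal.toReal_mono (ENNReal.add_ne_top.2 ⟨ENNReal.ofReal_ne_top, ENNReal.ofReal_ne_top⟩)
    ((ENNReal.add_le_add_iff_left hE).1 h7)
  rw [ENNReal.toReal_add (hXtop Φ) ENNReal.ofReal_ne_top,
    ENNReal.toReal_add ENNReal.ofReal_ne_top ENNReal.ofReal_ne_top, ENNReal.toReal_ofReal hε.le,
    ENNReal.toReal_ofReal (by positivity : (0 : ℝ) ≤ a + ε / 4), ENNReal.toReal_ofReal hε'0.le,
    ENNReal.toReal_mul] at h7r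
  -- a member of the subsequence `ε'`-close to `η`, hence `2ε'`-close to `Φ` in `L²(cell)`
  obtain ⟨j, hj⟩ := (Metric.tendsto_atTop.1 hconv ε' hε'0).imp fun j h => h j le_rfl
  rw [dist_eq_norm] at hj
  have hdist : Real.sqrt (∫ X in cellN N L, ‖Φ.ψ X - (Ψ (ψ₁ (φ₂ j))).ψ X‖ ^ 2) ≤ 2 * ε' := by
    rw [← norm_formEmbed_sub_formEmbed_sq hL Φ (Ψ (ψ₁ (φ₂ j))), Real.sqrt_sq (norm_nonneg _)]
    refine (norm_sub_le_norm_sub_add_norm_sub _ η _).trans ?_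
    rw [norm_sub_rev η]
    linarith [hΦdist, hj.le]
  -- `n_p` is `2N`-Lipschitz on the unit sphere of `L²(cell)`
  have hLip := abs_toReal_cellOccupation_planeWaveMode_sub_le hL p Φ.contDiff.continuous
    (Ψ (ψ₁ (φ₂ j))).contDiff.continuous Φ.norm_eq.le (Ψ (ψ₁ (φ₂ j))).norm_eq.le
  have hN0 : (0 : ℝ) ≤ N := Nat.cast_nonneg N
  have h1 : (cellOccupation N L (planeWaveMode L p) (Ψ (ψ₁ (φ₂ j))).ψ).toReal -
      (cellOccupation N L (planeWaveMode L p) Φ.ψ).toReal ≤ 2 * N * (2 * ε') :=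
    (abs_sub_le_iff.1 hLip).2.trans (mul_le_mul_of_nonneg_left hdist (by positivity))
  have h3 := mul_le_mul_of_nonneg_left h1 hsr0
  -- the subsequence member has `X_p` within `ε/4` of `a`
  have h4 := (abs_lt.1 (hclose (φ₂ j))).1
  rw [hx, ENNReal.toReal_mul] at h4
  linarith

/-! ## The registered stub: thermodynamic assembly -/

/-- **Stub W2 `stub_uniformTower_of_modePrice` (necessity of the tower shadow, per potential).** For every
admissible `v`: SMS for `v` (constants `C, ρ₀`, eventually in `N`, all `p ≠ 0`) ⇒ height-uniform SMS along the
truncation tower `min(v,n)` with constant `2C`, the level threshold depending on `(N, p)`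
(`towerModePrice_fixedVolume` with `ε = Cρ`; `E₀(v; N, L_N) < ⊤` eventually at small density by Ruelle
finiteness `exists_eventually_periodicGroundStateEnergy_lt_top`). [cite: LSSY2005, §1.2 (1.17)–(1.18)] -/
theorem stub_uniformTower_of_modePrice :
    ∀ v : ℝ → ℝ≥0∞, IsRepulsiveFiniteRange v →
      (∃ C : ℝ, 0 < C ∧ ∃ ρ₀ : ℝ, 0 < ρ₀ ∧ ∀ ρ : ℝ, 0 < ρ → ρ < ρ₀ →
        ∀ᶠ N : ℕ in atTop, ∀ p : Fin 3 → ℤ, p ≠ 0 →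
          ∀ Ψ : PeriodicTrialState N (sideLength ρ N),
            periodicGroundStateEnergy v N (sideLength ρ N)
                + 2⁻¹ * fracDispersion 2 (sideLength ρ N) p
                  * cellOccupation N (sideLength ρ N) (planeWaveMode (sideLength ρ N) p) Ψ.ψ
              ≤ periodicEnergy v Ψ + ENNReal.ofReal (C * ρ)) →
      ∃ C : ℝ, 0 < C ∧ ∃ ρ₀ : ℝ, 0 < ρ₀ ∧ ∀ ρ : ℝ, 0 < ρ → ρ < ρ₀ →
        ∀ᶠ N : ℕ in atTop, ∀ p : Fin 3 → ℤ, p ≠ 0 → ∃ n₀ : ℕ, ∀ n : ℕ, n₀ ≤ n →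
          ∀ Ψ : PeriodicTrialState N (sideLength ρ N),
            periodicGroundStateEnergy (fun r => min (v r) (n : ℝ≥0∞)) N (sideLength ρ N)
                + 2⁻¹ * fracDispersion 2 (sideLength ρ N) p
                  * cellOccupation N (sideLength ρ N) (planeWaveMode (sideLength ρ N) p) Ψ.ψ
              ≤ periodicEnergy (fun r => min (v r) (n : ℝ≥0∞)) Ψ + ENNReal.ofReal (C * ρ) := by
  intro v hv hS
  obtain ⟨C, hC, ρ₀, hρ₀, h⟩ := hS
  obtain ⟨ρ₁, hρ₁, hfin⟩ :=
    Literature.Barriers.AtomisticToContinuum.BoseGas.exists_eventually_periodicGroundStateEnergy_lt_top hv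
  refine ⟨2 * C, by positivity, min ρ₀ ρ₁, lt_min hρ₀ hρ₁, fun ρ hρ hρlt => ?_⟩
  have hρ0 : ρ < ρ₀ := hρlt.trans_le (min_le_left _ _)
  have hρ1 : ρ < ρ₁ := hρlt.trans_le (min_le_right _ _)
  filter_upwards [h ρ hρ hρ0, hfin ρ hρ hρ1, eventually_gt_atTop 0] with N hN hEN hN0
  intro p hp
  have hL : 0 < sideLength ρ N := sideLength_pos_of_pos hρ hN0
  have hCρ : 0 < C * ρ := mul_pos hC hρ
  obtain ⟨n₀, hn₀⟩ := towerModePrice_fixedVolume v hv hL hEN.ne p ENNReal.ofReal_ne_top (hN p hp) hCρ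
  refine ⟨n₀, fun n hn Ψ => (hn₀ n hn Ψ).trans_eq ?_⟩
  rw [add_assoc, ← ENNReal.ofReal_add hCρ.le hCρ.le]
  congr 2
  ring

end Summit.AtomisticToContinuum.BoseEinsteinCondensation.Cruxes.ModePriceHardCore.TowerShadow

end
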